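import Summits.AtomisticToContinuum.BoseEinsteinCondensation.Theorems.BECInfDivCoherenceLevyMassCondensationTranslation
import HarnessLib

/-!
# The translation coherence is even on the grid (stub `stub_cohGridEven`)

Support lemma for the birth skeleton of the crux
`BECInfDivCoherence.GridInfDivCoherence` (item stmt-AtomisticToContinuum-9114).

For a periodic `C¹` trial state `Ψ` of `N` bosons on the torus of side `L` and a particle `i`, the
translation coherence `G(r) = Re ∫_{cell^N} conj Ψ(…, xᵢ + r, …) Ψ(X) dX` satisfies

* `coh_add_latticeVec` — `G(r + L n) = G(r)` for `n ∈ ℤ³` (periodicity of `Ψ` in particle `i`);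
* `coh_neg` — `G(-r) = G(r)`: by `one_sub_coh_eq`, `1 - G(±r) = ½ ∫_{cell^N} ‖Ψ(X ± r eᵢ) - Ψ(X)‖²`,
  and the two cell integrals agree by the shift `X ↦ X + r eᵢ` of the fundamental cell
  (`lintegral_cellN_comp_add`, the integrand being periodic);
* `latticeVec_grid_neg` — the grid node of `-j ∈ (ℤ/m)³` is `-(node of j)` plus a vector of `Lℤ³`
  (coordinatewise `(L/m)·((m - j_k) % m) = -(L/m) j_k + L·[j_k ≠ 0]`);

whence `stub_cohGridEven`: `G(r_{-j}) = G(r_j)` on the grid `r_j = (L/m) j`, `j ∈ (ℤ/m)³`.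
-/

noncomputable section

namespace Summit.AtomisticToContinuum.BoseEinsteinCondensation.Theorems.CohGridEven

open MeasureTheory Literature.MathematicalPhysics.QuantumManyBody.BoseGas
open Summit.AtomisticToContinuum.BoseEinsteinCondensation.Theorems.InfDivGlue
open scoped ENNReal ComplexConjugate

/-- **Lattice periodicity of the coherence**: `G(r + L n) = G(r)` for `n ∈ ℤ³`. [folklore] -/
theorem coh_add_latticeVec {N : ℕ} {L : ℝ} (Ψ : PeriodicTrialState N L) (i : Fin N) (r : Space)
    (n : Fin 3 → ℤ) :
    (∫ X in cellN N L, conj (Ψ.ψ (Function.update X i (X i + (r + latticeVec L n)))) *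
        Ψ.ψ X).re =
      (∫ X in cellN N L, conj (Ψ.ψ (Function.update X i (X i + r))) * Ψ.ψ X).re := by
  have hper : IsTorusPeriodic L Ψ.ψ := Ψ.periodic
  congr 1
  refine integral_congr_ae (ae_of_all _ fun X => ?_)
  simp only
  rw [update_eq_add_single, update_eq_add_single, Pi.single_add, ← add_assoc,
    hper.add_single_latticeVec]

/-- **Evenness of the coherence**: `G(-r) = G(r)`. Both `1 - G(-r)` and `1 - G(r)` are half the
cell integral of an `L²`-increment (`one_sub_coh_eq`), and
`∫_{cell^N} ‖Ψ(X - r eᵢ) - Ψ(X)‖² = ∫_{cell^N} ‖Ψ(X + r eᵢ) - Ψ(X)‖²` by the shift `X ↦ X + r eᵢ`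
of the fundamental cell of the periodic integrand (`lintegral_cellN_comp_add`). [folklore] -/
theorem coh_neg {N : ℕ} {L : ℝ} (hL : 0 < L) (Ψ : PeriodicTrialState N L) (i : Fin N)
    (r : Space) :
    (∫ X in cellN N L, conj (Ψ.ψ (Function.update X i (X i + -r))) * Ψ.ψ X).re =
      (∫ X in cellN N L, conj (Ψ.ψ (Function.update X i (X i + r))) * Ψ.ψ X).re := by
  have hc := Ψ.contDiff.continuous
  have h1 := one_sub_coh_eq hL Ψ i (-r)
  have h2 := one_sub_coh_eq hL Ψ i r
  have hF1 : Continuous fun X : Config N => Ψ.ψ (X + Pi.single i (-r)) - Ψ.ψ X :=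
    (hc.comp (by fun_prop)).sub hc
  have hF2 : Continuous fun X : Config N => Ψ.ψ (X + Pi.single i r) - Ψ.ψ X :=
    (hc.comp (by fun_prop)).sub hc
  have key : ∫ X in cellN N L, ‖Ψ.ψ (X + Pi.single i (-r)) - Ψ.ψ X‖ ^ 2 =
      ∫ X in cellN N L, ‖Ψ.ψ (X + Pi.single i r) - Ψ.ψ X‖ ^ 2 := by
    rw [integral_cellN_norm_sq_eq_toReal L hF1, integral_cellN_norm_sq_eq_toReal L hF2]
    congr 1
    -- shift of the fundamental cell by `r eᵢ` for the periodic integrand `‖Ψ(X - r eᵢ) - Ψ(X)‖²`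
    have hshift := lintegral_cellN_comp_add hL
      (G := fun X => (‖Ψ.ψ (X + (Pi.single i (-r) : Config N)) - Ψ.ψ X‖₊ : ℝ≥0∞) ^ 2)
      (fun X j k => by rw [add_right_comm, Ψ.periodic, Ψ.periodic]) (Pi.single i r)
    rw [← hshift]
    refine lintegral_congr fun X => ?_
    rw [add_assoc, ← Pi.single_add, add_neg_cancel, Pi.single_zero, add_zero, ← neg_sub,
      nnnorm_neg]
  linarith

/-- **The grid is symmetric modulo the period lattice**: for `j ∈ (ℤ/m)³`, the node
`(L/m)·(-j)` (negation in `(ℤ/m)³`, coordinates `(m - j_k) % m`) equals `-(L/m)·j` plus the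
lattice vector `L·([j_k ≠ 0])_k ∈ Lℤ³`. [folklore] -/
theorem latticeVec_grid_neg {L : ℝ} {m : ℕ} [NeZero m] (j : Fin 3 → Fin m) :
    latticeVec (L / m) (fun k => (((-j) k : ℕ) : ℤ)) =
      -latticeVec (L / m) (fun k => ((j k : ℕ) : ℤ)) +
        latticeVec L (fun k => if j k = 0 then 0 else 1) := by
  have hm : (m : ℝ) ≠ 0 := Nat.cast_ne_zero.mpr (NeZero.ne m)
  ext k
  simp only [latticeVec, PiLp.toLp_apply, PiLp.add_apply, PiLp.neg_apply, Pi.neg_apply,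
    Fin.val_neg, Int.cast_natCast]
  split_ifs with h
  · simp [h]
  · push_cast [Nat.cast_sub (j k).isLt.le]
    field_simp
    ring

end Summit.AtomisticToContinuum.BoseEinsteinCondensation.Theorems.CohGridEven

namespace Summit.AtomisticToContinuum.BoseEinsteinCondensation.Theorems

open MeasureTheory Literature.MathematicalPhysics.QuantumManyBody.BoseGas
open Summit.AtomisticToContinuum.BoseEinsteinCondensation.Theorems.CohGridEven
open scoped ENNReal ComplexConjugate

/-- **`stub_cohGridEven`**. The translation coherence
`G(r) = Re ∫_{cell^N} conj Ψ(…, xᵢ + r, …) Ψ(X) dX` of a periodic trial state is an even function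
of the grid node: `G(r_{-j}) = G(r_j)` for `j ∈ (ℤ/m)³`, `r_j = (L/m) j` (`-j` taken in `(Fin m)³`).
Proof: `r_{-j} = -r_j + L n` with `n ∈ ℤ³` (`latticeVec_grid_neg`), `G` is `Lℤ³`-periodic
(`coh_add_latticeVec`) and even (`coh_neg`: shift invariance of the cell integral of the periodic
`L²`-increment, via `one_sub_coh_eq`). [folklore] -/
theorem stub_cohGridEven :
    ∀ (N : ℕ) (L : ℝ), 0 < L → ∀ (m : ℕ) [NeZero m] (Ψ : PeriodicTrialState N L) (i : Fin N)
      (j : Fin 3 → Fin m),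
      (∫ X in cellN N L, conj (Ψ.ψ (Function.update X i
          (X i + latticeVec (L / m) (fun k => (((-j) k : ℕ) : ℤ))))) * Ψ.ψ X).re =
      (∫ X in cellN N L, conj (Ψ.ψ (Function.update X i
          (X i + latticeVec (L / m) (fun k => ((j k : ℕ) : ℤ))))) * Ψ.ψ X).re := by
  intro N L hL m _ Ψ i j
  rw [latticeVec_grid_neg j, coh_add_latticeVec, coh_neg hL]

end Summit.AtomisticToContinuum.BoseEinsteinCondensation.Theorems
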